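/-
Copyright (c) 2026 the pub-hodgecm-mathlib formalisation cell (harness21).  Prover seat hodgecm-mathlib-K2E5-p16 (g4): Track B «K2-LIT»,
hLiu418 = stmt-HodgeConjecture-24832, ROAD Φ organ Φ6b-5 (abstract form): HOLOMORPHY OF `h`-SERIES OF THE CONTINUATION `Ξ(g, h; α, β)` along
complex lines — the archimedean summation step of the Fourier-expansion continuation, modulo the lattice count (a `Summable` hypothesis); 2026-09-04.
-/
import Summits.HodgeConjecture.HodgeConjecture.Theorems.K2LiuHermTwoEtaGrowthUniform             -- ★∕📤 p858194 (this seat): growth on boxes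
import Summits.HodgeConjecture.HodgeConjecture.Theorems.K2LiuHermTwoEtaLineHolomorphy            -- ★ p858177 (this seat): `Ξ` along lines
import Mathlib.Analysis.Complex.LocallyUniformLimit
import HarnessLib

/-!
# Crux `HLiu418`, ROAD Φ, organ Φ6b-5 (abstract): `s ↦ Σ_i c_i(s) · Ξ(g, h_i; α₀ + u s, β₀ + v s)` is holomorphic
# [Shimura1982, §3 + the Weierstrass M-test; Case II, m = κ = 2]

Cell `hodgecm-mathlib`, crux item hLiu418 = `stmt-HodgeConjecture-24832`, route of record `HCCMUnconditional`; squad K2, LEAD F0P6-plan (g12), co-dealer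
K2E5-plan (g5), prover K2E5-p16 (g4).  THEOREMS ONLY; lane `--supports stmt-HodgeConjecture-24832 --as helper`.

THE SUMMATION STEP (`differentiableOn_tsum_xiEta`).  Let `g > 0`, `(h_i)_{i ∈ ι}` positive definite, `U ⊂ ℂ` open with `re(β₀ + v s) > 1` on `U`,
coefficients `c_i` holomorphic on `U` of polynomial growth in `tr h_i` locally uniformly on `U`, and assume the LATTICE SUMMABILITY
  `∀ N N′, Σ_i e^{−2π Re tr(h_i g)} (1 + tr h_i)^N (1 + det(h_i)^{−N′}) < ∞`
(for `h_i` running through the positive part of a lattice of Hermitian matrices this is an elementary count).  Then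
  `s ↦ Σ_i c_i(s) · 4π⁴ e^{iπ(β−α)} Γ₂(α)⁻¹ Γ₂(β)⁻¹ η(2g, πh_i; α, β)|_{(α, β) = (α₀ + u s, β₀ + v s)}`
is complex-differentiable on `U` — ★ `norm_xiEtaRhs_le₂` (growth, locally uniform in `(α, β)`) + ★ `differentiableOn_xiEta_affine` + Mathlib's
`differentiableOn_tsum_of_summable_norm` on small balls.  The diagonal `(a + s, b + s)` of Road Φ is `u = v = 1`.
HONEST LABEL.  Count-neutral helper of the K2_Liu road; it pays no socket by itself: `HC_CM` is proved only modulo the 7 printed citations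
(2 remaining named inputs: hLiu418 = `stmt-HodgeConjecture-24832`, h413 = `stmt-HodgeConjecture-24833`) until rung 0 closes.
-/

set_option autoImplicit false
-- the mandated namespace repeats the single-problem summit's segment (`HodgeConjecture.HodgeConjecture`)
set_option linter.dupNamespace false

noncomputable section

open Complex MeasureTheory Set
open scoped ComplexOrder ComplexConjugate

namespace Summit.HodgeConjecture.HodgeConjecture.Cruxes.HLiu418.K2LiuHermTwoXiSeries

open Summit.HodgeConjecture.HodgeConjecture.Cruxes.HLiu418.K2LiuHermTwoGammaDefs
open Summit.HodgeConjecture.HodgeConjecture.Cruxes.HLiu418.K2LiuHermTwoEtaDefs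
open Summit.HodgeConjecture.HodgeConjecture.Cruxes.HLiu418.K2LiuHermTwoEtaConvergence
open Summit.HodgeConjecture.HodgeConjecture.Cruxes.HLiu418.K2LiuHermTwoEtaLineHolomorphy
open Summit.HodgeConjecture.HodgeConjecture.Cruxes.HLiu418.K2LiuHermTwoEtaGrowthUniform

/-- The trace of a positive definite Hermitian `2 × 2` matrix is positive (real parts of the diagonal). -/
theorem trace_re_pos_of_posDef {h : Matrix (Fin 2) (Fin 2) ℂ} (hh : h.PosDef) : 0 < (h 0 0).re + (h 1 1).re := by
  have hc := (posDef_hermTwo_iff ((h 0 0).re, h 0 1, (h 1 1).re)).mp (by rw [hermTwo_eq_of_isHermitian hh.1]; exact hh)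
  have h2 : 0 < (h 1 1).re := snd_pos_of_cone hc.1 hc.2
  linarith [hc.1]

/-- **HOLOMORPHY OF `h`-SERIES OF `Ξ` ALONG COMPLEX LINES** (organ Φ6b-5, abstract form): see the module docstring. -/
theorem differentiableOn_tsum_xiEta {ι : Type*} {g : Matrix (Fin 2) (Fin 2) ℂ} (hg : g.PosDef) (h : ι → Matrix (Fin 2) (Fin 2) ℂ)
    (hh : ∀ i, (h i).PosDef) (α₀ β₀ u v : ℂ) {U : Set ℂ} (hU : IsOpen U) (hU1 : ∀ s ∈ U, 1 < (β₀ + v * s).re)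
    (c : ι → ℂ → ℂ) (hc : ∀ i, DifferentiableOn ℂ (c i) U)
    (hcb : ∀ K ⊆ U, IsCompact K → ∃ A M : ℝ, 0 ≤ A ∧ ∀ i, ∀ s ∈ K, ‖c i s‖ ≤ A * (1 + ((h i 0 0).re + (h i 1 1).re)) ^ M)
    (hsum : ∀ N N' : ℝ, Summable fun i => Real.exp (-(2 * Real.pi * ((h i * g).trace).re)) *
      (1 + ((h i 0 0).re + (h i 1 1).re)) ^ N * (1 + ((h i 0 0).re * (h i 1 1).re - normSq (h i 0 1)) ^ (-N'))) :
    DifferentiableOn ℂ (fun s : ℂ => ∑' i, c i s *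
      (((4 * Real.pi ^ 4 : ℝ) : ℂ) * cexp ((Real.pi * I) * ((β₀ + v * s) - (α₀ + u * s))) * (hermTwoGamma (α₀ + u * s))⁻¹ *
        (hermTwoGamma (β₀ + v * s))⁻¹ * etaTwo ((2 : ℂ) • g) ((Real.pi : ℂ) • h i) (α₀ + u * s) (β₀ + v * s))) U := by
  intro s₀ hs₀
  obtain ⟨r, hr, hball⟩ := Metric.isOpen_iff.mp hU s₀ hs₀
  have hr2 : 0 < r / 2 := by linarith
  -- a compact ball inside `U` and its images on the two exponent lines
  have hKU : Metric.closedBall s₀ (r / 2) ⊆ U := (Metric.closedBall_subset_ball (by linarith)).trans hball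
  have hKc : IsCompact (Metric.closedBall s₀ (r / 2)) := isCompact_closedBall _ _
  have hKα : IsCompact ((fun s : ℂ => α₀ + u * s) '' Metric.closedBall s₀ (r / 2)) := hKc.image (by fun_prop)
  have hLβ : IsCompact ((fun s : ℂ => β₀ + v * s) '' Metric.closedBall s₀ (r / 2)) := hKc.image (by fun_prop)
  have hL1 : ∀ β ∈ (fun s : ℂ => β₀ + v * s) '' Metric.closedBall s₀ (r / 2), 1 < β.re := by
    rintro β ⟨s, hs, rfl⟩
    exact hU1 s (hKU hs)
  obtain ⟨C, N, N', hC, hN, hN', hB⟩ := norm_xiEtaRhs_le₂ hg hKα hLβ hL1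
  obtain ⟨A, M, hA, hcK⟩ := hcb _ hKU hKc
  have hBK : Metric.ball s₀ (r / 2) ⊆ Metric.closedBall s₀ (r / 2) := Metric.ball_subset_closedBall
  -- holomorphy on the open ball by the M-test
  suffices hD : DifferentiableOn ℂ (fun s : ℂ => ∑' i, c i s *
      (((4 * Real.pi ^ 4 : ℝ) : ℂ) * cexp ((Real.pi * I) * ((β₀ + v * s) - (α₀ + u * s))) * (hermTwoGamma (α₀ + u * s))⁻¹ *
        (hermTwoGamma (β₀ + v * s))⁻¹ * etaTwo ((2 : ℂ) • g) ((Real.pi : ℂ) • h i) (α₀ + u * s) (β₀ + v * s))) (Metric.ball s₀ (r / 2)) from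
    (hD.differentiableAt (Metric.isOpen_ball.mem_nhds (Metric.mem_ball_self hr2))).differentiableWithinAt
  refine differentiableOn_tsum_of_summable_norm
    (u := fun i => A * C * (Real.exp (-(2 * Real.pi * ((h i * g).trace).re)) *
      (1 + ((h i 0 0).re + (h i 1 1).re)) ^ (M + N) * (1 + ((h i 0 0).re * (h i 1 1).re - normSq (h i 0 1)) ^ (-N'))))
    ((hsum (M + N) N').mul_left (A * C)) (fun i => ?_) Metric.isOpen_ball (fun i s hs => ?_)
  · -- each term is holomorphic on the ball
    exact ((hc i).mono (hBK.trans hKU)).mul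
      ((differentiableOn_xiEta_affine hg (hh i) α₀ β₀ u v).mono fun s hs => hU1 s (hKU (hBK hs)))
  · -- the M-test bound
    have h1 := hcK i s (hBK hs)
    have h2 := hB (h i) (hh i) (α₀ + u * s) ⟨s, hBK hs, rfl⟩ (β₀ + v * s) ⟨s, hBK hs, rfl⟩
    have htr : 0 < 1 + ((h i 0 0).re + (h i 1 1).re) := by linarith [trace_re_pos_of_posDef (hh i)]
    rw [norm_mul]
    calc ‖c i s‖ * ‖((4 * Real.pi ^ 4 : ℝ) : ℂ) * cexp ((Real.pi * I) * ((β₀ + v * s) - (α₀ + u * s))) * (hermTwoGamma (α₀ + u * s))⁻¹ *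
          (hermTwoGamma (β₀ + v * s))⁻¹ * etaTwo ((2 : ℂ) • g) ((Real.pi : ℂ) • h i) (α₀ + u * s) (β₀ + v * s)‖
        ≤ (A * (1 + ((h i 0 0).re + (h i 1 1).re)) ^ M) *
            (C * Real.exp (-(2 * Real.pi * ((h i * g).trace).re)) * (1 + ((h i 0 0).re + (h i 1 1).re)) ^ N *
              (1 + ((h i 0 0).re * (h i 1 1).re - normSq (h i 0 1)) ^ (-N'))) :=
          mul_le_mul h1 h2 (norm_nonneg _) (by positivity)
      _ = A * C * (Real.exp (-(2 * Real.pi * ((h i * g).trace).re)) *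
            (1 + ((h i 0 0).re + (h i 1 1).re)) ^ (M + N) * (1 + ((h i 0 0).re * (h i 1 1).re - normSq (h i 0 1)) ^ (-N'))) := by
          rw [Real.rpow_add htr]
          ring

/-- THE DIAGONAL OF ROAD Φ (`u = v = 1`): `s ↦ Σ_i c_i(s) Ξ(g, h_i; a + s, b + s)` is holomorphic on any open `U ⊂ {re(b + s) > 1}` under the same
coefficient growth and lattice summability hypotheses. -/
theorem differentiableOn_tsum_xiEta_diag {ι : Type*} {g : Matrix (Fin 2) (Fin 2) ℂ} (hg : g.PosDef) (h : ι → Matrix (Fin 2) (Fin 2) ℂ)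
    (hh : ∀ i, (h i).PosDef) (a b : ℂ) {U : Set ℂ} (hU : IsOpen U) (hU1 : ∀ s ∈ U, 1 < (b + s).re)
    (c : ι → ℂ → ℂ) (hc : ∀ i, DifferentiableOn ℂ (c i) U)
    (hcb : ∀ K ⊆ U, IsCompact K → ∃ A M : ℝ, 0 ≤ A ∧ ∀ i, ∀ s ∈ K, ‖c i s‖ ≤ A * (1 + ((h i 0 0).re + (h i 1 1).re)) ^ M)
    (hsum : ∀ N N' : ℝ, Summable fun i => Real.exp (-(2 * Real.pi * ((h i * g).trace).re)) *
      (1 + ((h i 0 0).re + (h i 1 1).re)) ^ N * (1 + ((h i 0 0).re * (h i 1 1).re - normSq (h i 0 1)) ^ (-N'))) :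
    DifferentiableOn ℂ (fun s : ℂ => ∑' i, c i s *
      (((4 * Real.pi ^ 4 : ℝ) : ℂ) * cexp ((Real.pi * I) * ((b + s) - (a + s))) * (hermTwoGamma (a + s))⁻¹ *
        (hermTwoGamma (b + s))⁻¹ * etaTwo ((2 : ℂ) • g) ((Real.pi : ℂ) • h i) (a + s) (b + s))) U := by
  have h1 := differentiableOn_tsum_xiEta hg h hh a b 1 1 hU (fun s hs => by rw [one_mul]; exact hU1 s hs) c hc hcb hsum
  simp only [one_mul] at h1
  exact h1

end Summit.HodgeConjecture.HodgeConjecture.Cruxes.HLiu418.K2LiuHermTwoXiSeries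

end
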